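/- Copyright: the b2b-balaban cell (near-miss cell 7), T⁴-continuum fan-out; row NE7b ROUND-2 swarm, seat
t4-ne7b-formalise-leaf-06 (gen 7) (road W-RP, sub-row «W-LAB», file 8: W-2T's five-clause `CellSide` from ONE cube reader
with FOUR clauses; INTENT journal l.17482).  Released under the licence of the surrounding project. -/
import Summits.QuantumFields.BalabanUV.T4Continuum.Support.HistoryChessboardGibbsCells
import Summits.QuantumFields.BalabanUV.T4Continuum.Support.HistoryChessboardLabelsPattern

/-!
# Road W-RP, sub-row «W-LAB», file 8: W-2T's CELL SIDE READ BY ONE CUBE READER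

Summits-side support leaf of the T⁴-continuum cell (rung (B)+1 on a FINITE torus only; NOT infinite volume, NOT the
mass gap, NOT the Clay statement; NOT a proof of the spine estimate NE7b).  Row NE7b, road **W-RP** (R-OWNER-23-2 ∕
R-OWNER-23-8), sub-row «W-LAB», file 8: the junction, BY NAME, of leaf-01 g9's W-2T file 1 (`HistoryChessboardGibbsCells`:
the FIVE cell-event clauses `CellSide` of W7's reading — the TWO-TERM event model makes every term clause a theorem) with
this sub-row's reader route (file 4 `HistoryChessboardLabelsReader`: `preimage_fibre_eq_of_reader`; file 6
`HistoryChessboardLabelsPattern`: `GibbsReaderPattern`; leaf-04 g7's 4t cube template theorems).  [folklore] bookkeeping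
over TREE theorems; ONE hypothesis SHAPE `structure ReaderCellSide … : Prop` (consumed only as a binder); no definition
of data, no `[cite:]` tag, no `Prop`-valued FACT minted (c1), no constant (c2∕c6), no exit ∕ socket ∕ `HistoryConstants`
file touched (c3); nothing of W-2T ∕ W7 ∕ 4t ∕ files 1–7 restated.

WHAT.  **`structure ReaderCellSide D g₀ hm₁ K P f r`** — FOUR clauses on ONE cube reader `f : Tower (F.P K) G K → Λ`:
`read_meas` (the bad fibres are events of the reference cube column `towerBox G K (L^{m₁}) K`), the pointwise `read_sym`,
`univ_le` ((U1)×(G2)), `r_nonneg`; **`ReaderCellSide.cellSide : CellSide D g₀ hm₁ K P (fun l c => {ω | f (towerTranslate K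
(cubeCorner … c) ω) = l}) r`** (`E_meas`∕`loc`∕`sym` by 4t's `tEvent_E_meas_cubes`∕`tEvent_loc_cubes`∕`tEvent_sym_cubes`);
hence W-2T's two-term readings `ReaderCellSide.gibbsCubeEvents`∕`.gibbsCubeSide os` BY NAME; projections
`GibbsReaderPattern.readerCellSide`, `GibbsReaderEvents.readerCellSide` (files 5∕6 ⇒ the four clauses).

HONEST SCOPE (R-OWNER-23-8 wording for road W-RP).  With W-2T's two-term model the per-cutoff display of road W for a
reader-labelled run is these FOUR clauses on ONE reader (which function of the reference cube column labels the field-size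
classes — that Bałaban's large-field classes per cube ARE its bad fibres: (EXT)∘(LOC) proper —, its box measurability,
its reflection symmetry, and `univ_le` = (B)'s content as a READING); the term side then carries W-2T's aggregate
small-field sandwich + rates per string.  Nothing of H3 ∕ (B) ∕ BetaPertH discharged; 0∕9 unchanged.  NE7b NOT proved;
spine 0∕9.  HONEST DEPENDENCY (cell): continuum YM on T⁴ ⇐ BetaPertH ∧ nine spine estimates (0/9 proved); BetaPertH ⇐
(D1) ∧ (D4) ∧ CAP+tail; G-an2-4 gates asym, D1 and NE2/3/4.  This file changes none of it.
-/

open Finset MeasureTheory Literature.Barriers.CriticalPhenomena.NonGibbs Literature.Probability.LatticeModels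
open Literature.MathematicalPhysics.QuantumFieldTheory.Balaban1983to89
open Literature.MathematicalPhysics.QuantumFieldTheory.Balaban1983to89.Missing
open Literature.MathematicalPhysics.QuantumFieldTheory.Balaban1983to89.T4Continuum
open Summit.QuantumFields.BalabanUV.T4Continuum HistoryChessboardEventsSplit HistoryChessboardEventsTower
open HistoryChessboardEventsCubes HistoryRPTowerLaw HistoryRPTowerCuts HistoryRPTowerTemplates HistoryRPTowerUniform
open HistoryChessboardEventsTemplates HistoryChessboardTowerRepr HistoryChessboardGibbsSide HistoryChessboardLabels
open HistoryChessboardLabelsReader HistoryChessboardLabelsGibbsReader HistoryChessboardLabelsPattern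
open HistoryChessboardGibbsCells

namespace Summit.QuantumFields.BalabanUV.T4Continuum.HistoryChessboardReaderCells

noncomputable section

variable {F : T4Family} {G : Type*} [GaugeGroup G] [MeasurableSpace G] [HaarData G] {Λ : Type*}

/-- **W-2T's CELL SIDE READ BY ONE CUBE READER** (HYPOTHESIS SHAPE — NOTHING asserted): the cell event of the bad label `l`
at the cube `c` is «the reader `f`, applied to the tower carried back by the cube's corner, reads `l`»; FOUR clauses.
[folklore] -/
structure ReaderCellSide (D : FiniteEpsData F G) (g₀ : ℕ → ℝ) {m₁ : ℕ} (hm₁ : m₁ ≤ F.m) (K : ℕ) (P : Finset Λ)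
    (f : Tower (F.P K) G K → Λ) (r : ℝ) : Prop where
  /-- (LOC): the reader's bad fibres are events of the reference cube column -/
  read_meas : ∀ l ∈ P, MeasurableSet[towerBox G K (F.L ^ m₁) K] (f ⁻¹' {l})
  /-- (R-sym), pointwise: the reader on the reflected tower = the reader on the tower carried to the mirror cube -/
  read_sym : ∀ (i : Fin 4) (ω : Tower (F.P K) G K),
    f (towerRefl i K ω) = f (towerTranslate K (-axisVec (F.P K) K i (F.L ^ m₁)) ω)
  /-- (U1)+(G2), ratio currency: the pattern «every cube reads the bad label `l`» has probability `≤ r^(N^4)` -/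
  univ_le : ∀ l ∈ P, (gibbsTower D g₀ K).real
    {ω | ∀ c : BlockIdx 4 (cubeCount F m₁), f (towerTranslate K (cubeCorner (sitesPerDir_top_eq F hm₁ K) c) ω) = l} ≤
      r ^ (cubeCount F m₁ ^ 4)
  /-- the per-cell rate is nonnegative -/
  r_nonneg : 0 ≤ r

variable {D : FiniteEpsData F G} {g₀ : ℕ → ℝ} {m₁ : ℕ} {hm₁ : m₁ ≤ F.m} {K : ℕ} {P : Finset Λ}
  {f : Tower (F.P K) G K → Λ} {r : ℝ}

/-- **THE READER CELL SIDE IS W-2T's FIVE-CLAUSE `CellSide`** for the reader's label events: `E_meas`∕`loc`∕`sym` by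
4t's cube template theorems through file 4's `preimage_fibre_eq_of_reader`, `univ_le` re-read through file 1's
`iInter_univ_labelSet` — all BY NAME. [folklore] -/
theorem ReaderCellSide.cellSide (H : ReaderCellSide D g₀ hm₁ K P f r) :
    CellSide D g₀ hm₁ K P
      (fun l c => {ω | f (towerTranslate K (cubeCorner (sitesPerDir_top_eq F hm₁ K) c) ω) = l}) r where
  E_meas := tEvent_E_meas_cubes (sitesPerDir_top_eq F hm₁ K) (tmpl := fun l => f ⁻¹' {l}) fun l hl =>
    measurableSet_of_towerBox (H.read_meas l hl)
  loc := tEvent_loc_cubes (Nat.le_add_left K F.m) (sitesPerDir_top_eq F hm₁ K) (tmpl := fun l => f ⁻¹' {l}) H.read_meas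
  sym := tEvent_sym_cubes (sitesPerDir_top_eq F hm₁ K) (tmpl := fun l => f ⁻¹' {l}) fun l _ i =>
    preimage_fibre_eq_of_reader (H.read_sym i) l
  univ_le l hl :=
    (congrArg (gibbsTower D g₀ K).real
      (iInter_univ_labelSet (fun ω c => f (towerTranslate K (cubeCorner (sitesPerDir_top_eq F hm₁ K) c) ω))
        l)).trans_le (H.univ_le l hl)
  r_nonneg := H.r_nonneg

/-- … hence W-2T's TWO-TERM events-only reading (terms `univ : Finset Bool`, bad class `{true}`, events `twoEv`) —
`CellSide.gibbsCubeEvents` BY NAME. [folklore] -/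
theorem ReaderCellSide.gibbsCubeEvents (H : ReaderCellSide D g₀ hm₁ K P f r) :
    GibbsCubeEvents D g₀ hm₁ K P (Finset.univ : Finset Bool) {true}
      (twoEv P fun l c => {ω | f (towerTranslate K (cubeCorner (sitesPerDir_top_eq F hm₁ K) c) ω) = l})
      (fun l c => {ω | f (towerTranslate K (cubeCorner (sitesPerDir_top_eq F hm₁ K) c) ω) = l}) r :=
  H.cellSide.gibbsCubeEvents

/-- … and, for EVERY loop string, W7's eleven-clause side of the two-term model with the weights DEFINED by `weight`
(`CellSide.gibbsCubeSide` BY NAME). [folklore] -/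
theorem ReaderCellSide.gibbsCubeSide (H : ReaderCellSide D g₀ hm₁ K P f r) (os : List (ULoop F)) :
    GibbsCubeSide D g₀ os hm₁ K P (Finset.univ : Finset Bool)
      (weight D g₀ os K
        (twoEv P fun l c => {ω | f (towerTranslate K (cubeCorner (sitesPerDir_top_eq F hm₁ K) c) ω) = l}))
      {true} (twoEv P fun l c => {ω | f (towerTranslate K (cubeCorner (sitesPerDir_top_eq F hm₁ K) c) ω) = l})
      (fun l c => {ω | f (towerTranslate K (cubeCorner (sitesPerDir_top_eq F hm₁ K) c) ω) = l}) r :=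
  H.cellSide.gibbsCubeSide os

/-- The four clauses are the reader part of file 6's `GibbsReaderPattern` (projection). [folklore] -/
theorem _root_.Summit.QuantumFields.BalabanUV.T4Continuum.HistoryChessboardLabelsPattern.GibbsReaderPattern.readerCellSide
    [Fintype Λ] [DecidableEq Λ] (H : GibbsReaderPattern D g₀ hm₁ K P f r) : ReaderCellSide D g₀ hm₁ K P f r :=
  ⟨fun l _ => H.read_meas l, H.read_sym, H.univ_le, H.r_nonneg⟩

/-- … and of file 5's `GibbsReaderEvents` (projection: the term side is forgotten). [folklore] -/
theorem
    _root_.Summit.QuantumFields.BalabanUV.T4Continuum.HistoryChessboardLabelsGibbsReader.GibbsReaderEvents.readerCellSide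
    {ι : Type*} {T : Finset ι} {Bad : Finset ι} {term : Tower (F.P K) G K → ι}
    (H : GibbsReaderEvents D g₀ hm₁ K P T Bad term f r) : ReaderCellSide D g₀ hm₁ K P f r :=
  ⟨H.read_meas, H.read_sym, H.univ_le, H.r_nonneg⟩

end

end Summit.QuantumFields.BalabanUV.T4Continuum.HistoryChessboardReaderCells
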